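import Mathlib
import Summits.Ventures.PercRepro2.Defs
import Summits.Ventures.PercRepro2.Independence
import Summits.Ventures.PercRepro2.Harris
import Summits.Ventures.PercRepro2.Graph
import Summits.Ventures.PercRepro2.Events
import Summits.Ventures.PercRepro2.GateCylinder
import Summits.Ventures.PercRepro2.CCTRootEdge
import Summits.Ventures.PercRepro2.CDNestedStep
import Summits.Ventures.PercRepro2.CDNestedRouteChain
import Summits.Ventures.PercRepro2.CDNestedRoute
import Summits.Ventures.PercRepro2.CDNestedEdgeLemmas
import Summits.Ventures.PercRepro2.CDNestedMixture
import Summits.Ventures.PercRepro2.CDNestedInternal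
import Summits.Ventures.PercRepro2.CDNestedRoutes
import Summits.Ventures.PercRepro2.CDCutVertex

/-!
# The nested-routes theorem under a weight vector with closed edges: the route hypothesis only on the
configurations the weights support (blind cell PercRepro2, mine-a g36; MINE-A.md §91.7)

The cut-vertex transfers of `CDCutAC` ask for (AC) on one side of a cut under the vector
`p[off F ↦ 0]` (the other side's edges closed).  A class theorem whose hypothesis is a ROUTE statement
(`CDNestedRoutes.cd_of_nested_routes'`: every configuration with `a₁ ↮ a₂` and `a₁ ↔ a₃` has some route
open) cannot be applied there directly — the closed edges still exist, and a configuration opening them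
may connect `a₁` to `a₃` off every route.  Those configurations carry no weight.  This file proves the
nested-routes theorem in (AC) form under `p[off F ↦ 0]` with the route hypothesis restricted to the
configurations closed off `F` (`ac_of_nested_routes_zeroOff`): the four required masses are unchanged
when the events are altered on weightless configurations (`prob_zeroOff_eq_of_eqOn_closed`), so the
set identities `Q ∩ e ∩ X = Q ∩ W ∩ X` of the proof become identities of probabilities, and the mixture
argument is the same.  With it the route lemma of a pure fan (`CDNestedFan.fan_route_of_conn`, which
needs every OPEN edge to be a rung or a spoke) serves the fan as the near side of a cut — see
`CDFanPocket`.  No definition; one seat.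
-/

namespace Summit.Ventures.PercRepro2

namespace CDNestedZeroOff

section ZeroOff

variable {E : Type*} [Fintype E] [DecidableEq E] {R : Type*} [CommRing R]

/-- **Weightless configurations do not count**: under the vector with the edges off `F` closed, two events
that agree on the configurations closed off `F` have the same probability. -/
lemma prob_zeroOff_eq_of_eqOn_closed (p : E → R) (F : Set E) [DecidablePred (· ∈ F)]
    {X Y : Set (Config E)}
    (hXY : ∀ ω : Config E, (∀ e, e ∉ F → ω e = false) → (ω ∈ X ↔ ω ∈ Y)) :
    prob (fun e => if e ∈ F then p e else 0) X = prob (fun e => if e ∈ F then p e else 0) Y := by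
  unfold prob
  refine Finset.sum_congr rfl fun ω _ => ?_
  by_cases hω : ∀ e, e ∉ F → ω e = false
  · have hmem := hXY ω hω
    by_cases hX : ω ∈ X
    · rw [Set.indicator_of_mem hX, Set.indicator_of_mem (hmem.1 hX)]
    · rw [Set.indicator_of_notMem hX, Set.indicator_of_notMem (fun h => hX (hmem.2 h))]
  · push Not at hω
    obtain ⟨e, he, hωe⟩ := hω
    have hz : weight (fun e' => if e' ∈ F then p e' else 0) ω = 0 :=
      CDCutVertex.weight_zeroOff_eq_zero p F he (by simpa using hωe)
    rw [Set.indicator_apply_eq_zero.2 (fun _ => hz), Set.indicator_apply_eq_zero.2 (fun _ => hz)]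

end ZeroOff

section Theorem

variable {V : Type*} {E : Type*} [Fintype E] [DecidableEq E] [Fintype V] [DecidableEq V]
  {R : Type*} [Field R] [LinearOrder R] [IsStrictOrderedRing R]

/-- **THE NESTED-ROUTES THEOREM, (AC) FORM, UNDER `p[off F ↦ 0]`, WITH THE ROUTE HYPOTHESIS ON THE
SUPPORTED CONFIGURATIONS ONLY.** Routes `L i` (`i < k`), walk-ordered from `a₁`, reaching `a₃`, with
nested vertex sets; every configuration CLOSED OFF `F` with `a₁ ↮ a₂` and `a₁ ↔ a₃` has some route open.
Then `P(Q U e f)·P(Q e) ≤ P(Q U e)·P(Q e f)` under the vector with the edges off `F` closed, for every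
up-set `𝓔`. -/
theorem ac_of_nested_routes_zeroOff (p : E → R) (hp : IsProbVec p) (F : Set E)
    [DecidablePred (· ∈ F)] {ends : E → Sym2 V} {a₁ a₂ a₃ o : V}
    (k : ℕ) (L : ℕ → List (E × V × V)) (B : ℕ → Finset E) (S : ℕ → Finset V)
    (hB : ∀ i, i < k → B i = (L i).foldl (fun acc t => insert t.1 acc) (∅ : Finset E))
    (hS : ∀ i, i < k → S i = (L i).foldl (fun acc t => insert t.2.2 acc) ({a₁} : Finset V))
    (hends : ∀ i, i < k → ∀ t ∈ L i, ends t.1 = s(t.2.1, t.2.2))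
    (hwalk : ∀ i, i < k → ∀ j (hj : j < (L i).length), ((L i).get ⟨j, hj⟩).2.1 ∈
      ({a₁} : Finset V) ∪ (((L i).take j).map (fun u => u.2.2)).toFinset)
    (h3 : ∀ i, i < k → a₃ ∈ S i)
    (hnest : ∀ l i, l < i → i < k → S l ⊆ S i) {𝓔 : Set (Set V)} (h𝓔 : IsUpperSet 𝓔)
    (hroute : ∀ ω : Config E, (∀ e, e ∉ F → ω e = false) → ¬ Conn ends ω a₁ a₂ →
      Conn ends ω a₁ a₃ → ∃ i, i < k ∧ ω ∈ GateCylinder.cylinder (B i)) :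
    prob (fun e => if e ∈ F then p e else 0) ((connEvent ends a₁ a₂)ᶜ ∩ clusterInEvent ends a₁ 𝓔 ∩
          connEvent ends a₁ a₃ ∩ connEvent ends a₂ o) *
        prob (fun e => if e ∈ F then p e else 0) ((connEvent ends a₁ a₂)ᶜ ∩ connEvent ends a₁ a₃) ≤
      prob (fun e => if e ∈ F then p e else 0) ((connEvent ends a₁ a₂)ᶜ ∩ clusterInEvent ends a₁ 𝓔 ∩
          connEvent ends a₁ a₃) *
        prob (fun e => if e ∈ F then p e else 0) ((connEvent ends a₁ a₂)ᶜ ∩ connEvent ends a₁ a₃ ∩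
          connEvent ends a₂ o) := by
  set q : E → R := fun e => if e ∈ F then p e else 0 with hqdef
  have hq : IsProbVec q := CDCutVertex.isProbVec_zeroOff hp F
  set Q := (connEvent ends a₁ a₂)ᶜ with hQdef
  set U := clusterInEvent ends a₁ 𝓔 with hUdef
  set e := connEvent ends a₁ a₃ with hedef
  set f := connEvent ends a₂ o with hfdef
  set W := ⋃ i ∈ Finset.range k, GateCylinder.cylinder (B i) with hW
  -- the routes join their vertex sets, contain `a₁`, and their edges are internal
  have hJ : ∀ i, i < k → ∀ ω : Config E, ω ∈ GateCylinder.cylinder (B i) →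
      ∀ v ∈ S i, Conn ends ω a₁ v := by
    intro i hi ω hω v hv
    rw [hB i hi] at hω
    rw [hS i hi] at hv
    exact CDNestedRoute.chain_joined (L i) ∅ {a₁} (CDNestedStep.joined_singleton ends ∅ a₁)
      (hends i hi) (hwalk i hi) ω hω v hv
  have ha₁ : ∀ i, i < k → a₁ ∈ S i := by
    intro i hi
    rw [hS i hi]
    exact CDNestedInternal.subset_foldl_insert (L i) {a₁} (Finset.mem_singleton_self a₁)
  have hint : ∀ i, i < k → ∀ b ∈ B i, ∃ x ∈ S i, ∃ y ∈ S i, ends b = s(x, y) := by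
    intro i hi b hb
    rw [hB i hi, CDNestedInternal.mem_foldl_insert_edges] at hb
    rcases hb with hb | ⟨t, ht, rfl⟩
    · exact absurd hb (Finset.notMem_empty b)
    · refine ⟨t.2.1, ?_, t.2.2, ?_, hends i hi t ht⟩
      · rw [hS i hi]; exact CDNestedInternal.fst_mem_foldl_of_walk (hwalk i hi) t ht
      · rw [hS i hi]; exact CDNestedInternal.snd_mem_foldl_insert (L i) {a₁} t ht
  -- the four events are determined by the connections
  have hconn : ∀ X : Set (Config E), (X = Q ∨ X = Q ∩ U ∨ X = Q ∩ f ∨ X = Q ∩ U ∩ f) →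
      ∀ ω ω' : Config E, (∀ u w, Conn ends ω u w ↔ Conn ends ω' u w) → (ω ∈ X ↔ ω' ∈ X) := by
    intro X hX ω ω' hc
    have hcl := CDNestedEdge.cluster_eq_of_conn_iff hc a₁
    rcases hX with rfl | rfl | rfl | rfl
    · simp only [Q, Set.mem_compl_iff, mem_connEvent, hc]
    · simp only [Q, U, Set.mem_inter_iff, Set.mem_compl_iff, mem_connEvent, mem_clusterInEvent, hc,
        hcl]
    · simp only [Q, f, Set.mem_inter_iff, Set.mem_compl_iff, mem_connEvent, hc]
    · simp only [Q, U, f, Set.mem_inter_iff, Set.mem_compl_iff, mem_connEvent, mem_clusterInEvent,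
        hc, hcl]
  -- the pointwise route equivalence on the supported configurations
  have hpt : ∀ ω : Config E, (∀ e, e ∉ F → ω e = false) → ω ∈ Q → (ω ∈ e ↔ ω ∈ W) := by
    intro ω hω hQ
    constructor
    · intro he
      obtain ⟨i, hi, hωi⟩ := hroute ω hω hQ he
      simp only [W, Set.mem_iUnion, Finset.mem_range, exists_prop]
      exact ⟨i, hi, hωi⟩
    · intro hW'
      simp only [W, Set.mem_iUnion, Finset.mem_range, exists_prop] at hW'
      obtain ⟨i, hi, hωi⟩ := hW'
      exact hJ i hi ω hωi a₃ (h3 i hi)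
  -- the four masses, with the required event replaced by the union of the route cylinders
  have pA : prob q (Q ∩ U ∩ e ∩ f) = prob q ((Q ∩ U ∩ f) ∩ W) :=
    prob_zeroOff_eq_of_eqOn_closed p F fun ω hω => by
      have h := hpt ω hω; simp only [Set.mem_inter_iff]; tauto
  have pB : prob q (Q ∩ U ∩ e) = prob q ((Q ∩ U) ∩ W) :=
    prob_zeroOff_eq_of_eqOn_closed p F fun ω hω => by
      have h := hpt ω hω; simp only [Set.mem_inter_iff]; tauto
  have pC : prob q (Q ∩ e ∩ f) = prob q ((Q ∩ f) ∩ W) :=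
    prob_zeroOff_eq_of_eqOn_closed p F fun ω hω => by
      have h := hpt ω hω; simp only [Set.mem_inter_iff]; tauto
  have pD : prob q (Q ∩ e) = prob q (Q ∩ W) :=
    prob_zeroOff_eq_of_eqOn_closed p F fun ω hω => by
      have h := hpt ω hω; simp only [Set.mem_inter_iff]; tauto
  -- the worlds and their weights
  have hwp : ∀ i, IsProbVec (GateCylinder.forceOpen q (B i)) :=
    fun i => GateCylinder.isProbVec_forceOpen hq (B i)
  have hν0 : ∀ i, 0 ≤ (∏ b ∈ B i, q b) * prob (GateCylinder.forceOpen q (B i))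
      (⋂ l ∈ Finset.range i, (GateCylinder.cylinder (B l))ᶜ) :=
    fun i => mul_nonneg (Finset.prod_nonneg fun b _ => hq.nonneg b) (prob_nonneg (hwp i) _)
  have hmass : ∀ X : Set (Config E), (X = Q ∨ X = Q ∩ U ∨ X = Q ∩ f ∨ X = Q ∩ U ∩ f) →
      prob q (X ∩ W) = ∑ i ∈ Finset.range k, ((∏ b ∈ B i, q b) *
        prob (GateCylinder.forceOpen q (B i)) (⋂ l ∈ Finset.range i, (GateCylinder.cylinder (B l))ᶜ)) *
          prob (GateCylinder.forceOpen q (B i)) X :=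
    fun X hX => CDNestedRoutes.prob_inter_routes_eq_sum q k B S hJ hint hnest X (hconn X hX)
  -- the internal-edge reduction of the forced set `B j ∪ B i` to `B j`, for `i < j`
  have hred : ∀ i j, i < j → j < k → ∀ X : Set (Config E),
      (X = Q ∨ X = Q ∩ U ∨ X = Q ∩ f ∨ X = Q ∩ U ∩ f) →
      prob (GateCylinder.forceOpen q ((L j).foldl (fun acc t => insert t.1 acc) (B i))) X =
        prob (GateCylinder.forceOpen q (B j)) X := by
    intro i j hij hj X hX
    have hint' : ∀ b ∈ B i, ∃ x ∈ S j, ∃ y ∈ S j, ends b = s(x, y) := by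
      intro b hb
      obtain ⟨x, hx, y, hy, hxy⟩ := hint i (by omega) b hb
      exact ⟨x, hnest i j hij hj hx, y, hnest i j hij hj hy, hxy⟩
    rw [CDNestedInternal.foldl_insert_edges_eq_union, ← hB j hj, Finset.union_comm]
    exact CDNestedInternal.prob_forceOpen_union_internal q (hJ j hj) hint' X (hconn X hX)
  -- the ordered propensities
  have hβ : ∀ i j, i < k → j < k → i ≤ j →
      prob (GateCylinder.forceOpen q (B i)) (Q ∩ U) * prob (GateCylinder.forceOpen q (B j)) Q ≤
        prob (GateCylinder.forceOpen q (B j)) (Q ∩ U) * prob (GateCylinder.forceOpen q (B i)) Q := by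
    intro i j hi hj hij
    rcases hij.lt_or_eq with hlt | rfl
    · have h := CDNestedRoute.chain_beta q hq (a₂ := a₂) h𝓔 (L j) (B i) (S i) (hJ i hi) (ha₁ i hi)
        (hends j hj) (CDNestedRoute.walk_mono (Finset.singleton_subset_iff.2 (ha₁ i hi)) (hwalk j hj))
      rw [hred i j hlt hj Q (Or.inl rfl), hred i j hlt hj (Q ∩ U) (Or.inr (Or.inl rfl))] at h
      exact h
    · exact le_rfl
  have hγ : ∀ i j, i < k → j < k → i ≤ j →
      prob (GateCylinder.forceOpen q (B j)) (Q ∩ f) * prob (GateCylinder.forceOpen q (B i)) Q ≤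
        prob (GateCylinder.forceOpen q (B i)) (Q ∩ f) * prob (GateCylinder.forceOpen q (B j)) Q := by
    intro i j hi hj hij
    rcases hij.lt_or_eq with hlt | rfl
    · have h := CDNestedRoute.chain_gamma q hq (a₂ := a₂) (o := o) (L j) (B i) (S i) (hJ i hi)
        (ha₁ i hi) (hends j hj)
        (CDNestedRoute.walk_mono (Finset.singleton_subset_iff.2 (ha₁ i hi)) (hwalk j hj))
      rw [hred i j hlt hj Q (Or.inl rfl), hred i j hlt hj (Q ∩ f) (Or.inr (Or.inr (Or.inl rfl)))] at h
      exact h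
    · exact le_rfl
  refine CDNestedMixture.ac_of_worlds q k (fun i => GateCylinder.forceOpen q (B i)) hwp ends
    a₁ a₂ a₃ o h𝓔 (fun i => (∏ b ∈ B i, q b) * prob (GateCylinder.forceOpen q (B i))
      (⋂ l ∈ Finset.range i, (GateCylinder.cylinder (B l))ᶜ)) hν0 ?_ ?_ ?_ ?_ hβ hγ
  · show prob q (Q ∩ U ∩ e ∩ f) = _
    rw [pA, hmass _ (Or.inr (Or.inr (Or.inr rfl)))]
  · show prob q (Q ∩ U ∩ e) = _
    rw [pB, hmass _ (Or.inr (Or.inl rfl))]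
  · show prob q (Q ∩ e ∩ f) = _
    rw [pC, hmass _ (Or.inr (Or.inr (Or.inl rfl)))]
  · show prob q (Q ∩ e) = _
    rw [pD, hmass _ (Or.inl rfl)]

end Theorem

end CDNestedZeroOff

end Summit.Ventures.PercRepro2
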